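/-
Copyright (c) 2026 the pub-hodgecm-mathlib formalisation cell (harness21).  Prover seat hodgecm-mathlib-K2E3-p29 (g2): Track B «K2-LIT», hLiu418 = stmt-HodgeConjecture-24832;
socket #41, KIND W; KW desk F0P2-p08 (g3) word 23:40:35Z «(iii-fin-Φ5) = (a) FIRST», cc LEAD F0P6-plan (g14).  THEOREMS ONLY (no `def`, no `instance`, no notation,
no named-fact hypothesis, no `sorry`).
-/
import Summits.HodgeConjecture.HodgeConjecture.Theorems.K2LiuKindWFiniteLetterDefs        -- ★ p863154 (iii-fin): `kindWFfin`, `kindWLocalBall`, `differentiable_kindWFfin_of_stable`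
import Summits.HodgeConjecture.HodgeConjecture.Theorems.K2LiuBadPlaceWhittakerRightTranslate -- ★ (this seat) `whittaker_ball_letters_rightTranslate` (⊇ ★ B4-Tate `K2LiuBadPlaceLocalFactorSkew`, ★ Φ5-tie, ★ B3, ★ Φ5-data)
import Summits.HodgeConjecture.HodgeConjecture.Theorems.K2LiuUnipDeltaLocalHaarTransport    -- ★ B2: `exists_homeomorph_skew_of_carrier`, `isAddHaarMeasure_map_skew`, `regular_map_skew`, `locallyCompactSpace_skew`
import Literature.NumberTheory.Automorphic.HeckeCharacterLocalComponentSmooth               -- ★ `HeckeCharacter.isOpen_ker_localComponent` (the `hχv` letter for Hecke characters)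
import HarnessLib

/-!
# Crux `HLiu418`, socket #41, KIND W — `K2LiuKindWFiniteLetterHolomorphic` ((iii-fin-Φ5)): THE HEAD's LETTER `hFfin` FOR `Ffin := kindWFfin` BY NAME —
# the far-shell stability ∕ differentiability inputs of ★ p863154 DISCHARGED by ★ B4 (chart transport) + ★ Φ5 (Karel's lemma, entire ball integrals) for local SIEGEL-SECTION families

Cell `hodgecm-mathlib`, crux item hLiu418 = `stmt-HodgeConjecture-24832` (helper lane `--supports … --as helper`, count-neutral), route of record `HCCMUnconditional`; squad K2 ∕
K2Liu, road `K2_Liu`, socket #41 `sig_K2LiuSiegelEisensteinContinuation`, KIND W.  ★ p863154 `K2LiuKindWFiniteLetterDefs` DEFINED the continued finite local letter of record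
`kindWFfin T₀ νv π FvT j S h v` (the limit of the Φ5-ball integrals of the local Whittaker integrand of the by-value local factor `FvT j S h v` on `N_Δ(L⁺_v)`) and reduced the head's
holomorphy letter `hFfin : ∀ j S h v, DifferentiableOn ℂ (Ffin j S h v) {0 < re s}` (★ `kindW_block_of_record`, ★ ED.4 `exists_kindW_eulerLetters_of_letters`) to two BY-VALUE inputs
at each place of the presentation: far-shell STABILITY of the ball integrals beyond one exponent `K` for every `s` (`hstable`) and DIFFERENTIABILITY of the `ball(−K)` integral (`hdiff`).
THIS FILE PAYS both for every family `FvT j S h v : ℂ → H(L⁺_v) → ℂ` of LOCAL SIEGEL SECTIONS (★ `IsLocalSiegelSection`, fixed open level `U_v`, continuous, entire in `s`, locally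
uniformly bounded on compacts — the `K_v`-finite flat families (KW-fac) constructs), at the glue's Skew-carrier currency `Sk := skewMatrices (conjLocal …) (gramS …)` (★ p863148 §2:
★ `mem_skewMatrices_iff` + `add_comm`; no new carrier type):
* §1 `gramS_eq_map`, **`beta_skew`**, **`beta_mul_betaInv`** — the index block `β := −½·(S ⊗ 1)` is `gramS`-skew-hermitian and `β · (−2·(S⁻¹ ⊗ 1)) = 1` at `det S ≠ 0` (★ p863148 §1's
  `n = 2` lemmas at general `n`, same proofs); `kindWLocalBall_eq_preimage` — ★ p863154's ball IS the preimage of ★ Φ5's Skew ball under the ★ B2 chart `ψc` (`(ψc u).1 = B(matA u)`);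
  **`setIntegral_kindWLocalBall_eq_setIntegral_skew_tate`** — ★ B4-Tate `integral_unipDeltaLoc_eq_integral_skew_tate` RESTRICTED TO BALLS (Mathlib `Measure.restrict_map` along the
  homeomorphism `ψc`): `∫_{ball_v(a)} conj ψ_S(ι_v y)·g(y) dν = ∫_{B(a)} g(n(t))·ψ_{L⁺,v}(−Tr tr(β t)) d(ψc_*ν)`; `exists_nhds_localComponent_unit_eq_one` — ★ Φ5's character
  letter `hχv` for the local components of a Hecke character (★ `HeckeCharacter.isOpen_ker_localComponent`, Mathlib `Units.isOpenMap_val`); **`skewCarrier_measure_letters`** — the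
  general-`n` twin of ★ `K2LiuGoodPlaceLocalFactor.skewCarrier_measure_letters` (`ψc_*ν` additive Haar and regular, `Skew` locally compact; ★ B2), packed once.
* §2 (one place of the presentation) **`differentiable_kindWFfin_of_isLocalSiegelSection`**: for `det S ≠ 0` and the local factor `FvT j S h v` a local Siegel-section family (letters
  `hf hU hfU hfc hdiff hbd` BY VALUE), `kindWFfin T₀ νv π FvT j S h v` is ENTIRE — ★ p863154 (T3) `differentiable_kindWFfin_of_stable` with both inputs paid by ★ (this seat, generic frame)
  `K2LiuBadPlaceWhittakerRightTranslate.whittaker_ball_letters_rightTranslate` (★ Φ5 `whittaker_setIntegral_ball_eq` ∕ `differentiable_whittaker` for the right translate `g ↦ f s (g·x)`,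
  every piece of auxiliary data — `μF`, Tate's `ψ_{L⁺,v}` and `Tr`, `ε, c_ε, c₂, b_T, b, b′` — discharged) at `(L⁺, L, c, imagUnit L, gramR, hermD)`, `x := h_v`, `β := −½·(S ⊗ 1)` (§1),
  the ★ B2 chart at `Sk := skewMatrices (conjLocal …) (gramS …)` and §1's measure letters, ★ B4 §1 `evalPlace_finPart_weylDelta` (`(w_Δ)_v` is ★ D10's local Weyl element) and the ball
  transport §1 (three times).
* §3 `kindWFfin_eq_zero_of_eq_zero` (a vanishing factor gives the letter `0`) and THE HEAD's LETTER VERBATIM **`hFfin_of_isLocalSiegelSection`**: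
  `∀ j S h v, DifferentiableOn ℂ (kindWFfin T₀ νv π FvT j S h v) {s | 0 < s.re}` from the Siegel-section letters of `FvT` at the non-singular indices and the convention `FvT j S h v = 0`
  at singular `S` (every upstream `FvT`-letter — ★ `hPart_of_letters`' factorisation and `hFfin` identity — is guarded by `det S ≠ 0`, and ★ ED.4 reads `hFfin` only inside its
  `det S ≠ 0` branch, so the convention costs the payer nothing); off `kindWFinset T₀ S h` the letter is the constant `0` (★ `kindWFfin_of_not_mem`).
[KudlaRallis1994, §2], [Shimura1997, §18.1 (18.4), §18.3–18.4], [Casselman1980, §3], [Weil1965, §37], [CasselsFrohlichANT1967, Ch. XV §2.2].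
HONEST LABEL.  Count-neutral helper, closes no socket: `HC_CM` is proved only modulo the 7 printed citations (2 remaining named inputs: hLiu418 = `stmt-HodgeConjecture-24832`, h413 =
`stmt-HodgeConjecture-24833`) until rung 0 closes.  NOT HERE (by value, per place of the presentation, payer (KW-fac)): the Siegel-section letters `hf hfU hfc hdiff hbd` of the concrete
`FvT` and its vanishing convention at singular indices.

## References
* [KudlaRallis1994] S. Kudla, S. Rallis, *A regularized Siegel–Weil formula: the first term identity*, Ann. of Math. 140 (1994): §2 (local Whittaker integrals of Siegel sections are entire).
* [Shimura1997] G. Shimura, *Euler products and Eisenstein series*, CBMS 93 (1997): §18.1 (18.4), §18.3–18.4.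
* [Casselman1980] W. Casselman, *The unramified principal series of p-adic groups I*, Compositio Math. 40 (1980): §3 (Karel's lemma: the Whittaker integral is a compact-ball integral).
* [Weil1965] A. Weil, *L'intégration dans les groupes topologiques et ses applications* (2nd ed. 1965): §37 (transport of Haar measure).
* [CasselsFrohlichANT1967] J. Tate, in Cassels–Fröhlich (eds.), *Algebraic Number Theory* (1967): Ch. XV §2.2 (local components of `ψ`, conductor); Ch. VII §4.3.
-/

set_option autoImplicit false
-- the mandated namespace repeats the single-problem summit's segment (`HodgeConjecture.HodgeConjecture`)
set_option linter.dupNamespace false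

noncomputable section

open scoped Matrix RestrictedProduct ENNReal NNReal Topology ComplexConjugate BigOperators
open NumberField IsDedekindDomain MeasureTheory Measure Filter Set Metric

namespace Summit.HodgeConjecture.HodgeConjecture.Cruxes.HLiu418.K2LiuKindWFiniteLetterHolomorphic

open Literature.NumberTheory.Automorphic Literature.NumberTheory.Automorphic.UnitaryGroup Literature.NumberTheory.GaloisRepresentations Literature.NumberTheory.LFunctions
open Literature.NumberTheory.GelbartRogawski1991 Literature.NumberTheory.GelbartRogawski1991.GRConstruction
open Literature.NumberTheory.GelbartRogawski1991.AdaptedBlocks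
open Literature.NumberTheory.GelbartRogawski1991.UnitaryDualPair
open Literature.NumberTheory.K2Lit Literature.NumberTheory.K2Lit.LocalSiegelDoubled Literature.NumberTheory.K2Lit.PlaceSplitting
open Summit.HodgeConjecture.HodgeConjecture.Cruxes.HLiu418.K2LiuSiegelUnipotentLocalDefs
open Summit.HodgeConjecture.HodgeConjecture.Cruxes.HLiu418.K2LiuSiegelUnipotentFourierDefs
open Summit.HodgeConjecture.HodgeConjecture.Cruxes.HLiu418.K2LiuSiegelEisensteinKindWLetters
open Summit.HodgeConjecture.HodgeConjecture.Cruxes.HLiu418.K2LiuUnipDeltaLocBridge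
open Summit.HodgeConjecture.HodgeConjecture.Cruxes.HLiu418.K2LiuUnipDeltaLocalHaarTransport
open Summit.HodgeConjecture.HodgeConjecture.Cruxes.HLiu418.K2LiuLocalWhittakerFactorSkew (evalPlace_finPart_weylDelta)
open Summit.HodgeConjecture.HodgeConjecture.Cruxes.HLiu418.K2LiuBadPlaceLocalFactorSkew (integral_unipDeltaLoc_eq_integral_skew_tate)
open Summit.HodgeConjecture.HodgeConjecture.Cruxes.HLiu418.K2LiuBadPlaceWhittakerRightTranslate (whittaker_ball_letters_rightTranslate)
open Summit.HodgeConjecture.HodgeConjecture.Cruxes.HLiu418.K2LiuKindWFiniteLetterDefs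

variable (L : Type) [Field L] [NumberField L] [IsCMField L]
variable {N M n : ℕ} (e : Fin N × Fin M ≃ Fin n)
  (dV : Fin N → L) (hdV : ∀ i, IsCMField.complexConj L (dV i) = dV i)
  (dW : Fin M → L) (hdW : ∀ i, IsCMField.complexConj L (dW i) = dW i)
  (hdV0 : ∀ i, dV i ≠ 0) (hdW0 : ∀ i, dW i ≠ 0)
  (v : HeightOneSpectrum (𝓞 (Fp L)))

/-! ## §1 The index block `β = −½·(S ⊗ 1)` at general `n`; balls and ball integrals through the ★ B2 chart; the `hχv` letter for Hecke characters -/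

section Beta

variable (S : ↥(skewMatrices ((IsCMField.complexConj L : L ≃ₐ[Fp L] L) : L →+* L) ((gramR L e dV hdV dW hdW).map (algebraMap (Fp L) L))))

/-- `gramS = (gramR ⊗ L) ⊗_L (L ⊗ L⁺_v)`: the local Gram matrix is the image of `gramR ⊗ L` under `L → ∏_{w∣v} L_w` (★ p863148 `gramS_eq_map` at general `n`). [folklore] -/
theorem gramS_eq_map :
    LocalSplitting.gramS (Fp L) L v n (gramR L e dV hdV dW hdW) = ((gramR L e dV hdV dW hdW).map (algebraMap (Fp L) L)).map (algebraMap L (LocalRing L v)) := by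
  refine Matrix.ext fun i j => funext fun w => ?_
  simp only [LocalSplitting.gramS, Matrix.map_apply, toLocalRing_apply, Pi.algebraMap_apply]
  exact toPlace_coe v w _

/-- **`β := −½·(S ⊗ 1)` IS `gramS`-SKEW-HERMITIAN** (★ Φ5's letter `hβskew`; ★ p863148 `beta_skew` at general `n`): the skew relation `(gramR⊗L)·S + σ(S)ᵀ·(gramR⊗L) = 0` of `S ∈ Skew`
mapped along `L → ∏_{w∣v} L_w` (`σ ⊗ 1` on scalars, ★ `conjLocal_algebraMap`) and scaled by the `σ`-fixed scalar `−½`. [cite: Shimura1997, §18.1] -/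
theorem beta_skew :
    ((-(⅟(2 : LocalRing L v) • (S : Matrix (Fin n) (Fin n) L).map (algebraMap L (LocalRing L v)))).map (conjLocal L (IsCMField.complexConj L) v))ᵀ *
        LocalSplitting.gramS (Fp L) L v n (gramR L e dV hdV dW hdW) +
      LocalSplitting.gramS (Fp L) L v n (gramR L e dV hdV dW hdW) *
        (-(⅟(2 : LocalRing L v) • (S : Matrix (Fin n) (Fin n) L).map (algebraMap L (LocalRing L v)))) = 0 := by
  set φ : L →+* LocalRing L v := algebraMap L (LocalRing L v) with hφ
  set S' : Matrix (Fin n) (Fin n) (LocalRing L v) := (S : Matrix (Fin n) (Fin n) L).map φ with hS'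
  set G' : Matrix (Fin n) (Fin n) (LocalRing L v) := ((gramR L e dV hdV dW hdW).map (algebraMap (Fp L) L)).map φ with hG'
  have hGS : LocalSplitting.gramS (Fp L) L v n (gramR L e dV hdV dW hdW) = G' := gramS_eq_map L e dV hdV dW hdW v
  -- the skew relation mapped along `φ`
  have hskew : G' * S' + (S'.map (conjLocal L (IsCMField.complexConj L) v))ᵀ * G' = 0 := by
    have h0 := (mem_skewMatrices_iff _ _ _).1 S.2
    have h1 := congrArg (RingHom.mapMatrix φ) h0
    rw [map_add, map_mul, map_mul, map_zero, RingHom.mapMatrix_apply, RingHom.mapMatrix_apply, RingHom.mapMatrix_apply] at h1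
    have hconj : (((S : Matrix (Fin n) (Fin n) L).map ((IsCMField.complexConj L : L ≃ₐ[Fp L] L) : L →+* L))ᵀ).map φ =
        (S'.map (conjLocal L (IsCMField.complexConj L) v))ᵀ := by
      ext i j
      simp only [Matrix.map_apply, Matrix.transpose_apply, hS', RingHom.coe_coe, hφ, conjLocal_algebraMap]
    rw [hconj] at h1
    exact h1
  -- `σ ⊗ 1` fixes `½`
  have hhalf : conjLocal L (IsCMField.complexConj L) v (⅟(2 : LocalRing L v)) = ⅟(2 : LocalRing L v) := by
    have h2 : conjLocal L (IsCMField.complexConj L) v (⅟(2 : LocalRing L v)) * 2 = 1 := by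
      have := congrArg (conjLocal L (IsCMField.complexConj L) v) (invOf_mul_self (2 : LocalRing L v))
      rwa [map_mul, map_ofNat, map_one] at this
    calc conjLocal L (IsCMField.complexConj L) v (⅟(2 : LocalRing L v))
        = conjLocal L (IsCMField.complexConj L) v (⅟(2 : LocalRing L v)) * 2 * ⅟(2 : LocalRing L v) := by rw [mul_assoc, mul_invOf_self, mul_one]
      _ = ⅟(2 : LocalRing L v) := by rw [h2, one_mul]
  have hmap : (-(⅟(2 : LocalRing L v) • S')).map (conjLocal L (IsCMField.complexConj L) v) = -(⅟(2 : LocalRing L v) • S'.map (conjLocal L (IsCMField.complexConj L) v)) := by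
    ext i j
    simp only [Matrix.map_apply, Matrix.neg_apply, Matrix.smul_apply, smul_eq_mul, map_neg, map_mul, hhalf]
  rw [hGS, hmap, Matrix.transpose_neg, Matrix.transpose_smul, Matrix.neg_mul, Matrix.smul_mul, Matrix.mul_neg, Matrix.mul_smul, ← neg_add, ← smul_add,
    add_comm, hskew, smul_zero, neg_zero]

/-- **`β · β⁻¹ = 1`** with `β⁻¹ := −2·(S⁻¹ ⊗ 1)` (★ Φ5's letter `hββ`; ★ p863148 `beta_mul_betaInv` at general `n`), `det S ≠ 0`. [cite: Shimura1997, §18.1] -/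
theorem beta_mul_betaInv (hdet : (S : Matrix (Fin n) (Fin n) L).det ≠ 0) :
    (-(⅟(2 : LocalRing L v) • (S : Matrix (Fin n) (Fin n) L).map (algebraMap L (LocalRing L v)))) *
        (-((2 : LocalRing L v) • (S : Matrix (Fin n) (Fin n) L)⁻¹.map (algebraMap L (LocalRing L v)))) = 1 := by
  rw [Matrix.neg_mul, Matrix.mul_neg, neg_neg, Matrix.smul_mul, Matrix.mul_smul, smul_smul, invOf_mul_self, one_smul, ← Matrix.map_mul,
    Matrix.mul_nonsing_inv _ (Ne.isUnit hdet), Matrix.map_one _ (map_zero _) (map_one _)]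

end Beta

section Chart

variable [MeasurableSpace ↥(unipDeltaLoc L e dV hdV dW hdW v)] [BorelSpace ↥(unipDeltaLoc L e dV hdV dW hdW v)]
  (Sk : AddSubgroup (Matrix (Fin n) (Fin n) (LocalRing L v)))
  (hSk : ∀ t, t ∈ Sk ↔ (t.map (conjLocal L (IsCMField.complexConj L) v))ᵀ * LocalSplitting.gramS (Fp L) L v n (gramR L e dV hdV dW hdW) +
    LocalSplitting.gramS (Fp L) L v n (gramR L e dV hdV dW hdW) * t = 0)
  [MeasurableSpace Sk] [BorelSpace Sk]
  {π : v.adicCompletion (Fp L)} (hπ : Valued.v π = WithZero.exp (-1 : ℤ))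

omit [MeasurableSpace ↥(unipDeltaLoc L e dV hdV dW hdW v)] [BorelSpace ↥(unipDeltaLoc L e dV hdV dW hdW v)] [MeasurableSpace Sk] [BorelSpace Sk] in
/-- **★ p863154's ball is the preimage of ★ Φ5's Skew ball under the ★ B2 chart** `ψc` (`(ψc u).1 = B(matA u)`). [cite: KudlaRallis1994, §2] -/
theorem kindWLocalBall_eq_preimage (ψc : ↥(unipDeltaLoc L e dV hdV dW hdW v) ≃ₜ Sk)
    (hψc : ∀ u, (ψc u).1 = blkB (LocalSplitting.matA (Fp L) L (IsCMField.complexConj L) v n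
      (u : UnitaryGroup.localPi L (IsCMField.complexConj L) (n + n) (hermD L e dV hdV dW hdW) v))) (π : v.adicCompletion (Fp L)) (a : ℤ) :
    kindWLocalBall L e dV hdV dW hdW v π a =
      ψc ⁻¹' {t : Sk | ∀ i j (w : UnitaryGroup.PlacesOver L v), Valued.v (t.1 i j w) ≤ Valued.v (UnitaryGroup.toPlace v w π) ^ a} := by
  ext y
  simp only [Set.mem_preimage, Set.mem_setOf_eq, mem_kindWLocalBall_iff, hψc]

include hSk hπ in
/-- **★ B4-Tate RESTRICTED TO BALLS**: for the Fourier index `S ∈ M_n(L)`, any `g : H(L⁺_v) → ℂ`, any measure `ν` on `N_Δ(L⁺_v)`, the ★ B2 chart `ψc` and every exponent `a`,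
`∫_{kindWLocalBall v π a} conj ψ_S(ι_v y)·g(y) dν(y) = ∫_{B(a)} g(n(t)) · ψ_{L⁺,v}(−Tr tr(β·t)) d(ψc_*ν)(t)`, `β = −½·(S ⊗ 1)` (Mathlib `Measure.restrict_map` along `ψc`:
`(ψc_*ν)|_{B(a)} = ψc_*(ν|_{ψc⁻¹ B(a)})`, then ★ `integral_unipDeltaLoc_eq_integral_skew_tate` for the restricted measure). [cite: Shimura1997, §18.1 (18.4)] [cite: Weil1965, §37] -/
theorem setIntegral_kindWLocalBall_eq_setIntegral_skew_tate (ψc : ↥(unipDeltaLoc L e dV hdV dW hdW v) ≃ₜ Sk)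
    (hψc : ∀ u, (ψc u).1 = blkB (LocalSplitting.matA (Fp L) L (IsCMField.complexConj L) v n
      (u : UnitaryGroup.localPi L (IsCMField.complexConj L) (n + n) (hermD L e dV hdV dW hdW) v)))
    (ν : Measure ↥(unipDeltaLoc L e dV hdV dW hdW v)) (S : Matrix (Fin n) (Fin n) L)
    (g : UnitaryGroup.localPi L (IsCMField.complexConj L) (n + n) (hermD L e dV hdV dW hdW) v → ℂ) (a : ℤ) :
    ∫ y in kindWLocalBall L e dV hdV dW hdW v π a, conj ((unipDeltaChar L e dV hdV dW hdW S (locToAdelic L e dV hdV dW hdW v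
        (y : UnitaryGroup.localPi L (IsCMField.complexConj L) (n + n) (hermD L e dV hdV dW hdW) v)) : Circle) : ℂ) *
      g (y : UnitaryGroup.localPi L (IsCMField.complexConj L) (n + n) (hermD L e dV hdV dW hdW) v) ∂ν =
    ∫ t in {t : Sk | ∀ i j (w : UnitaryGroup.PlacesOver L v), Valued.v (t.1 i j w) ≤ Valued.v (UnitaryGroup.toPlace v w π) ^ a},
      g (LocalSplitting.nElem (Fp L) L (IsCMField.complexConj L) v n (hermD_eq_map_gramD L e dV hdV dW hdW) t.1 ((hSk t.1).1 t.2)) *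
        ((adeleAddCharAt (Fp L) v (-(Algebra.trace (v.adicCompletion (Fp L)) (LocalRing L v)
          (Matrix.trace ((-(⅟(2 : LocalRing L v) • S.map (algebraMap L (LocalRing L v)))) * t.1)))) : Circle) : ℂ) ∂(Measure.map ψc ν) := by
  rw [Measure.restrict_map ψc.measurable (K2LiuSkewLatticeShells.measurableSet_ball (Fp L) L v hπ n Sk a),
    ← kindWLocalBall_eq_preimage L e dV hdV dW hdW v Sk ψc hψc π a]
  exact integral_unipDeltaLoc_eq_integral_skew_tate L e dV hdV dW hdW v Sk hSk ψc hψc (ν.restrict (kindWLocalBall L e dV hdV dW hdW v π a)) S g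

include hSk in
set_option maxHeartbeats 800000 in -- MEASURED: 400 000 ✗ (`isDefEq`, the three ★ B2 heads' CM frame telescope) ∕ 800 000 ✓ (★ `K2LiuGoodPlaceLocalFactor.skewCarrier_measure_letters`, the `n = 2` twin: (400 000, 600 000]); plain `exact`, no search tactics
/-- **THE SKEW-CARRIER MEASURE LETTERS IN THE CM FRAME, general `n`**: `ψc_*ν` is an additive Haar measure on `Skew` and regular, and `Skew` is locally compact — ★ B2
`isAddHaarMeasure_map_skew` ∕ `regular_map_skew` ∕ `locallyCompactSpace_skew` at `N′ := unipDeltaLoc v` (★ B1 `mem_unipDeltaLoc_iff_mem_unipDeltaLocal`); packed once (the general-`n`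
twin of ★ `K2LiuGoodPlaceLocalFactor.skewCarrier_measure_letters`, `n = 2`) so that §2 pays the frame telescope a single time. [cite: Weil1965, §37] [cite: Casselman1980, §3] -/
theorem skewCarrier_measure_letters (ψc : ↥(unipDeltaLoc L e dV hdV dW hdW v) ≃ₜ Sk)
    (hψc : ∀ u, (ψc u).1 = blkB (LocalSplitting.matA (Fp L) L (IsCMField.complexConj L) v n
      (u : UnitaryGroup.localPi L (IsCMField.complexConj L) (n + n) (hermD L e dV hdV dW hdW) v)))
    (ν : Measure ↥(unipDeltaLoc L e dV hdV dW hdW v)) [ν.IsHaarMeasure] :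
    (Measure.map ψc ν).IsAddHaarMeasure ∧ (Measure.map ψc ν).Regular ∧ LocallyCompactSpace Sk := by
  haveI : Algebra.IsQuadraticExtension (Fp L) L := IsCMField.isQuadraticExtension L
  have hN := mem_unipDeltaLoc_iff_mem_unipDeltaLocal L e dV hdV dW hdW v
  exact ⟨isAddHaarMeasure_map_skew (Fp L) L (IsCMField.complexConj L) v n (hermD_eq_map_gramD L e dV hdV dW hdW) hN hSk ψc hψc ν,
    regular_map_skew (Fp L) L (IsCMField.complexConj L) v n (hermD_eq_map_gramD L e dV hdV dW hdW) hN hSk ψc hψc ν,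
    locallyCompactSpace_skew (Fp L) L (IsCMField.complexConj L) v n hSk⟩

end Chart

omit [IsCMField L] in
/-- **★ Φ5's character letter `hχv` for a Hecke character**: each local component `χ_w` is trivial on a neighbourhood of `1` in `L_w` (its kernel is an open subgroup of `L_wˣ`,
★ `HeckeCharacter.isOpen_ker_localComponent`; `L_wˣ → L_w` is an open map, Mathlib `Units.isOpenMap_val`). [cite: CasselsFrohlichANT1967, Ch. VII §4.3] -/
theorem exists_nhds_localComponent_unit_eq_one (χ : HeckeCharacter L) (w : UnitaryGroup.PlacesOver L v) :
    ∃ V ∈ 𝓝 (1 : w.1.adicCompletion L), ∀ x ∈ V, ∀ hx : IsUnit x, χ.localComponent w.1 hx.unit = 1 := by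
  have hU : IsOpen (Units.val '' (((χ.localComponent w.1).ker : Subgroup (w.1.adicCompletion L)ˣ) : Set (w.1.adicCompletion L)ˣ)) :=
    Units.isOpenMap_val _ (χ.isOpen_ker_localComponent w.1)
  refine ⟨_, hU.mem_nhds ⟨1, (χ.localComponent w.1).ker.one_mem, Units.val_one⟩, fun x hx hxu => ?_⟩
  obtain ⟨u, hu, hux⟩ := hx
  have h : hxu.unit = u := Units.ext (by rw [IsUnit.unit_spec, hux])
  rw [h]
  exact (MonoidHom.mem_ker).1 hu

/-! ## §2 At one place of the presentation: `kindWFfin … j S h v` is ENTIRE for a local SIEGEL-SECTION factor (the CM frame objects constructed) -/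

section OnePlace

variable [∀ v : HeightOneSpectrum (𝓞 (Fp L)), MeasurableSpace ↥(unipDeltaLoc L e dV hdV dW hdW v)]
  [∀ v : HeightOneSpectrum (𝓞 (Fp L)), BorelSpace ↥(unipDeltaLoc L e dV hdV dW hdW v)]

include hdV0 hdW0 in
set_option maxHeartbeats 1600000 in -- MEASURED: 1 200 000 ✗ (`isDefEq` at the last ball transport) ∕ 1 600 000 ✓ — one §2 application + ★ B2 chart + `skewCarrier_measure_letters` + ★ p863154 (T3) + three ball transports, all in the CM frame (the class of ★ glue `integral_unipDeltaLoc_lambdaLoc_eq_of_one_lt_re`, 800 000); plain `obtain`∕`refine`∕`exact`, no search tactics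
/-- **`kindWFfin T₀ νv π FvT j S h v` IS ENTIRE AT A PLACE OF THE PRESENTATION, FOR A LOCAL SIEGEL-SECTION FACTOR.**  K2Lit CM datum (`dV`, `dW` non-zero); uniformisers `π v`
(`hπ`); Haar carriers `νv`; a NON-SINGULAR skew index `S` (`hdet`), `h ∈ H(𝔸)`, a place `v ∈ kindWFinset T₀ S h`; a local character family `χ_v = (χ_w)_{w∣v}` trivial near `1` (`hχv`;
for Hecke characters §1 `exists_nhds_localComponent_unit_eq_one`); and the local factor `FvT j S h v : ℂ → H(L⁺_v) → ℂ` a family of local SIEGEL SECTIONS for `χ_v` (`hf`, ★ `IsLocalSiegelSection`)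
of a fixed open level `U` (`hU`, `hfU`), continuous (`hfc`), entire in `s` at each point (`hdiff`), locally-in-`s` uniformly bounded on compacts (`hbd`).  THEN
**`Differentiable ℂ (kindWFfin T₀ νv π FvT j S h v)`**.  PROOF: ★ p863154 `differentiable_kindWFfin_of_stable`, its two inputs paid by §2 `whittaker_ball_letters_rightTranslate` at the CM frame
`(L⁺, L, c, imagUnit L, gramR, hermD)` with `x := h_v`, the Skew chart ★ B2 `exists_homeomorph_skew_of_carrier` at `Sk := skewMatrices (conjLocal …) (gramS …)` and its measure letters
(§1 `skewCarrier_measure_letters`), the index block `β = −½·(S ⊗ 1)` (§1 `beta_skew`, `beta_mul_betaInv`), ★ B4 §1 `evalPlace_finPart_weylDelta`, and the ball transport §1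
`setIntegral_kindWLocalBall_eq_setIntegral_skew_tate` (three times: the two stable balls and the holomorphic one).
[cite: Casselman1980, §3] [cite: KudlaRallis1994, §2] [cite: Shimura1997, §18.3–18.4] [cite: Weil1965, §37] -/
theorem differentiable_kindWFfin_of_isLocalSiegelSection [Algebra.IsQuadraticExtension (Fp L) L]
    (T₀ : Finset (HeightOneSpectrum (𝓞 (Fp L))))
    (νv : ∀ v : HeightOneSpectrum (𝓞 (Fp L)), Measure ↥(unipDeltaLoc L e dV hdV dW hdW v))
    {π : ∀ v : HeightOneSpectrum (𝓞 (Fp L)), v.adicCompletion (Fp L)} (hπ : ∀ v, Valued.v (π v) = WithZero.exp (-1 : ℤ)) {m : ℕ}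
    (FvT : Fin m → ∀ (S : skewMatrices ((IsCMField.complexConj L : L ≃ₐ[Fp L] L) : L →+* L) ((gramR L e dV hdV dW hdW).map (algebraMap (Fp L) L)))
      (h : HA L e dV hdV dW hdW) (v : (kindWFinset L e dV hdV dW hdW T₀ (S : Matrix (Fin n) (Fin n) L) h)),
      ℂ → UnitaryGroup.localPi L (IsCMField.complexConj L) (n + n) (hermD L e dV hdV dW hdW) v.1 → ℂ)
    (j : Fin m) (S : skewMatrices ((IsCMField.complexConj L : L ≃ₐ[Fp L] L) : L →+* L) ((gramR L e dV hdV dW hdW).map (algebraMap (Fp L) L)))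
    (h : HA L e dV hdV dW hdW) (v : (kindWFinset L e dV hdV dW hdW T₀ (S : Matrix (Fin n) (Fin n) L) h)) [(νv v.1).IsHaarMeasure]
    (hdet : (S : Matrix (Fin n) (Fin n) L).det ≠ 0)
    {χv : ∀ w : UnitaryGroup.PlacesOver L v.1, (w.1.adicCompletion L)ˣ →* ℂˣ}
    (hχv : ∀ w : UnitaryGroup.PlacesOver L v.1, ∃ V ∈ 𝓝 (1 : w.1.adicCompletion L), ∀ z ∈ V, ∀ hz : IsUnit z, χv w hz.unit = 1)
    (hf : ∀ s, IsLocalSiegelSection (Fp L) L (IsCMField.complexConj L) (complexConj_imagUnit L) (imagUnit_ne_zero L) (imagUnit_mul_self L) v.1 n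
      (gramR_isSymm L e dV hdV dW hdW) (hermD_eq_map_gramD L e dV hdV dW hdW) χv s (FvT j S h v s))
    {U : Subgroup (UnitaryGroup.localPi L (IsCMField.complexConj L) (n + n) (hermD L e dV hdV dW hdW) v.1)}
    (hU : IsOpen (U : Set (UnitaryGroup.localPi L (IsCMField.complexConj L) (n + n) (hermD L e dV hdV dW hdW) v.1)))
    (hfU : ∀ s g k, k ∈ U → FvT j S h v s (g * k) = FvT j S h v s g) (hfc : ∀ s, Continuous (FvT j S h v s))
    (hdiff : ∀ g, Differentiable ℂ fun s => FvT j S h v s g)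
    (hbd : ∀ Kc : Set (UnitaryGroup.localPi L (IsCMField.complexConj L) (n + n) (hermD L e dV hdV dW hdW) v.1), IsCompact Kc →
      ∀ s₀ : ℂ, ∃ r > 0, ∃ C : ℝ, ∀ s ∈ Metric.ball s₀ r, ∀ g ∈ Kc, ‖FvT j S h v s g‖ ≤ C) :
    Differentiable ℂ (kindWFfin L e dV hdV dW hdW T₀ νv π FvT j S h v.1) := by
  -- the Skew chart of ★ B2 at the glue's carrier `Sk := skewMatrices (conjLocal …) (gramS …)` (★ p863148 §2), with its Borel σ-algebra and the transported Haar measure (§1)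
  set Sk : AddSubgroup (Matrix (Fin n) (Fin n) (LocalRing L v.1)) :=
    skewMatrices (conjLocal L (IsCMField.complexConj L) v.1) (LocalSplitting.gramS (Fp L) L v.1 n (gramR L e dV hdV dW hdW)) with hSkdef
  have hSk : ∀ t, t ∈ Sk ↔ (t.map (conjLocal L (IsCMField.complexConj L) v.1))ᵀ * LocalSplitting.gramS (Fp L) L v.1 n (gramR L e dV hdV dW hdW) +
      LocalSplitting.gramS (Fp L) L v.1 n (gramR L e dV hdV dW hdW) * t = 0 :=
    fun t => (mem_skewMatrices_iff _ _ t).trans (by rw [add_comm])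
  letI : MeasurableSpace ↥Sk := borel _
  haveI : BorelSpace ↥Sk := ⟨rfl⟩
  obtain ⟨ψc, hψc, -⟩ := exists_homeomorph_skew_of_carrier (F := Fp L) (E := L) (c := IsCMField.complexConj L) (v := v.1) (n := n)
    (hJD := hermD_eq_map_gramD L e dV hdV dW hdW) (N' := unipDeltaLoc L e dV hdV dW hdW v.1) (hN' := mem_unipDeltaLoc_iff_mem_unipDeltaLocal L e dV hdV dW hdW v.1)
    (S := Sk) (hS := hSk)
  obtain ⟨hHaar, hReg, hLC⟩ := skewCarrier_measure_letters L e dV hdV dW hdW v.1 Sk hSk ψc hψc (νv v.1)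
  haveI := hHaar; haveI := hReg; haveI := hLC
  -- §2 at the CM frame, right translation `x := h_v`, index block `β = −½·(S ⊗ 1)` (§1)
  obtain ⟨K, hKst, hKdiff⟩ := whittaker_ball_letters_rightTranslate (Fp L) L (IsCMField.complexConj L) (complexConj_imagUnit L) (imagUnit_ne_zero L) (imagUnit_mul_self L) v.1 n
    (gramR_isSymm L e dV hdV dW hdW) (isUnit_det_gramR₀ L e dV hdV hdV0 dW hdW hdW0) (hermD_eq_map_gramD L e dV hdV dW hdW) (hπ v.1) Sk hSk (Measure.map ψc (νv v.1))
    hχv hU hf hfU hfc hdiff hbd (beta_skew L e dV hdV dW hdW v.1 S) (beta_mul_betaInv L e dV hdV dW hdW v.1 S hdet)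
    (UnitaryGroup.evalPlace (Fp L) L (IsCMField.complexConj L) (n + n) (hermD L e dV hdV dW hdW) v.1
      (UnitaryGroup.finPart (Fp L) L (IsCMField.complexConj L) (n + n) (hermD L e dV hdV dW hdW) h))
  -- ★ p863154 (T3): holomorphy from stability + differentiability of one ball integral
  refine differentiable_kindWFfin_of_stable L e dV hdV dW hdW T₀ νv π FvT j S h v K (fun s k hk => ?_) ?_
  · -- stability: ★ B4 §1 + the ball transport §1 on both sides, then §2
    rw [evalPlace_finPart_weylDelta]
    exact (setIntegral_kindWLocalBall_eq_setIntegral_skew_tate L e dV hdV dW hdW v.1 Sk hSk (hπ v.1) ψc hψc (νv v.1) (S : Matrix (Fin n) (Fin n) L)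
      (fun y => FvT j S h v s (LocalSplitting.weylDelta (Fp L) L (IsCMField.complexConj L) v.1 n (hermD_eq_map_gramD L e dV hdV dW hdW) * y *
        UnitaryGroup.evalPlace (Fp L) L (IsCMField.complexConj L) (n + n) (hermD L e dV hdV dW hdW) v.1
          (UnitaryGroup.finPart (Fp L) L (IsCMField.complexConj L) (n + n) (hermD L e dV hdV dW hdW) h))) (-(k : ℤ))).trans
      ((hKst s k hk).trans (setIntegral_kindWLocalBall_eq_setIntegral_skew_tate L e dV hdV dW hdW v.1 Sk hSk (hπ v.1) ψc hψc (νv v.1) (S : Matrix (Fin n) (Fin n) L)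
      (fun y => FvT j S h v s (LocalSplitting.weylDelta (Fp L) L (IsCMField.complexConj L) v.1 n (hermD_eq_map_gramD L e dV hdV dW hdW) * y *
        UnitaryGroup.evalPlace (Fp L) L (IsCMField.complexConj L) (n + n) (hermD L e dV hdV dW hdW) v.1
          (UnitaryGroup.finPart (Fp L) L (IsCMField.complexConj L) (n + n) (hermD L e dV hdV dW hdW) h))) (-(K : ℤ))).symm)
  · -- holomorphy: §2's entire Skew-ball integral, transported by §1 pointwise in `s`
    intro s₀
    refine (hKdiff s₀).congr_of_eventuallyEq (Filter.Eventually.of_forall fun s => ?_)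
    rw [evalPlace_finPart_weylDelta]
    exact setIntegral_kindWLocalBall_eq_setIntegral_skew_tate L e dV hdV dW hdW v.1 Sk hSk (hπ v.1) ψc hψc (νv v.1) (S : Matrix (Fin n) (Fin n) L)
      (fun y => FvT j S h v s (LocalSplitting.weylDelta (Fp L) L (IsCMField.complexConj L) v.1 n (hermD_eq_map_gramD L e dV hdV dW hdW) * y *
        UnitaryGroup.evalPlace (Fp L) L (IsCMField.complexConj L) (n + n) (hermD L e dV hdV dW hdW) v.1
          (UnitaryGroup.finPart (Fp L) L (IsCMField.complexConj L) (n + n) (hermD L e dV hdV dW hdW) h))) _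

end OnePlace

/-! ## §3 THE HEAD's LETTER `hFfin` VERBATIM for `Ffin := kindWFfin T₀ νv π FvT` -/

section Head

variable [∀ v : HeightOneSpectrum (𝓞 (Fp L)), MeasurableSpace ↥(unipDeltaLoc L e dV hdV dW hdW v)]
  [∀ v : HeightOneSpectrum (𝓞 (Fp L)), BorelSpace ↥(unipDeltaLoc L e dV hdV dW hdW v)]

omit [∀ v : HeightOneSpectrum (𝓞 (Fp L)), BorelSpace ↥(unipDeltaLoc L e dV hdV dW hdW v)] in
/-- **A VANISHING FACTOR GIVES THE LETTER `0`**: at a place `v ∈ kindWFinset T₀ S h`, if `FvT j S h v s = 0` identically (the payer's convention at the SINGULAR indices `S`, where no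
upstream letter reads `FvT`), then `kindWFfin … j S h v s = 0` (every ball integral vanishes). [cite: KudlaRallis1994, §2] -/
theorem kindWFfin_eq_zero_of_eq_zero (T₀ : Finset (HeightOneSpectrum (𝓞 (Fp L))))
    (νv : ∀ v : HeightOneSpectrum (𝓞 (Fp L)), Measure ↥(unipDeltaLoc L e dV hdV dW hdW v))
    (π : ∀ v : HeightOneSpectrum (𝓞 (Fp L)), v.adicCompletion (Fp L)) {m : ℕ}
    (FvT : Fin m → ∀ (S : skewMatrices ((IsCMField.complexConj L : L ≃ₐ[Fp L] L) : L →+* L) ((gramR L e dV hdV dW hdW).map (algebraMap (Fp L) L)))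
      (h : HA L e dV hdV dW hdW) (v : (kindWFinset L e dV hdV dW hdW T₀ (S : Matrix (Fin n) (Fin n) L) h)),
      ℂ → UnitaryGroup.localPi L (IsCMField.complexConj L) (n + n) (hermD L e dV hdV dW hdW) v.1 → ℂ)
    (j : Fin m) (S : skewMatrices ((IsCMField.complexConj L : L ≃ₐ[Fp L] L) : L →+* L) ((gramR L e dV hdV dW hdW).map (algebraMap (Fp L) L)))
    (h : HA L e dV hdV dW hdW) {v : HeightOneSpectrum (𝓞 (Fp L))} (hv : v ∈ kindWFinset L e dV hdV dW hdW T₀ (S : Matrix (Fin n) (Fin n) L) h)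
    (hF0 : ∀ (s : ℂ) (g : UnitaryGroup.localPi L (IsCMField.complexConj L) (n + n) (hermD L e dV hdV dW hdW) v), FvT j S h ⟨v, hv⟩ s g = 0) (s : ℂ) :
    kindWFfin L e dV hdV dW hdW T₀ νv π FvT j S h v s = 0 := by
  rw [kindWFfin, dif_pos hv]
  simp only [hF0, mul_zero, integral_zero]
  exact tendsto_const_nhds.limUnder_eq

include hdV0 hdW0 in
/-- **THE HEAD's HOLOMORPHY LETTER `hFfin`, VERBATIM, FOR `Ffin := kindWFfin T₀ νv π FvT` BY NAME** (★ `kindW_block_of_record`'s ∕ ★ ED.4 `exists_kindW_eulerLetters_of_letters`' binder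
`hFfin : ∀ j S h v, DifferentiableOn ℂ (Ffin j S h v) {s | 0 < s.re}`).  K2Lit CM datum (`dV`, `dW` non-zero), bad set `T₀`, Haar carriers `νv`, uniformisers `π` (`hπ`), local character
families `χ_v` trivial near `1` (`hχv`; for the local components of a Hecke character §1 `exists_nhds_localComponent_unit_eq_one`), and the local factors `FvT` of the `T(S,h)`-part (★
`hPart_of_letters`' dependent shape) subject, at every place `v ∈ kindWFinset T₀ S h` of a NON-SINGULAR index, to the local Siegel-section letters BY VALUE — `hf` (Siegel for `χ_v`), `hfU`
(a fixed open level), `hfc` (continuous), `hdiff` (entire in `s`), `hbd` (locally uniformly bounded on compacts) — and, at the SINGULAR indices, to the vanishing convention `hF0` (free for the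
payer: ★ `hPart_of_letters`' factorisation and `hFfin`-identity letters and ★ ED.4's use of `hFfin` are all guarded by `det S ≠ 0`).  THEN
**`∀ j S h v, DifferentiableOn ℂ (kindWFfin T₀ νv π FvT j S h v) {s | 0 < s.re}`** — §3 at the places of the presentation with `det S ≠ 0` (entire, a fortiori on the half-plane),
`kindWFfin_eq_zero_of_eq_zero` at singular `S`, ★ `kindWFfin_of_not_mem` (the constant `0`) off `kindWFinset T₀ S h`.
[cite: KudlaRallis1994, §2] [cite: Shimura1997, §18.3–18.4] [cite: Casselman1980, §3] -/
theorem hFfin_of_isLocalSiegelSection [Algebra.IsQuadraticExtension (Fp L) L]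
    (T₀ : Finset (HeightOneSpectrum (𝓞 (Fp L))))
    (νv : ∀ v : HeightOneSpectrum (𝓞 (Fp L)), Measure ↥(unipDeltaLoc L e dV hdV dW hdW v)) [∀ v, (νv v).IsHaarMeasure]
    {π : ∀ v : HeightOneSpectrum (𝓞 (Fp L)), v.adicCompletion (Fp L)} (hπ : ∀ v, Valued.v (π v) = WithZero.exp (-1 : ℤ)) {m : ℕ}
    (FvT : Fin m → ∀ (S : skewMatrices ((IsCMField.complexConj L : L ≃ₐ[Fp L] L) : L →+* L) ((gramR L e dV hdV dW hdW).map (algebraMap (Fp L) L)))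
      (h : HA L e dV hdV dW hdW) (v : (kindWFinset L e dV hdV dW hdW T₀ (S : Matrix (Fin n) (Fin n) L) h)),
      ℂ → UnitaryGroup.localPi L (IsCMField.complexConj L) (n + n) (hermD L e dV hdV dW hdW) v.1 → ℂ)
    (χv : ∀ v : HeightOneSpectrum (𝓞 (Fp L)), ∀ w : UnitaryGroup.PlacesOver L v, (w.1.adicCompletion L)ˣ →* ℂˣ)
    (hχv : ∀ (v : HeightOneSpectrum (𝓞 (Fp L))) (w : UnitaryGroup.PlacesOver L v), ∃ V ∈ 𝓝 (1 : w.1.adicCompletion L), ∀ z ∈ V, ∀ hz : IsUnit z, χv v w hz.unit = 1)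
    (hf : ∀ (j : Fin m) (S : skewMatrices ((IsCMField.complexConj L : L ≃ₐ[Fp L] L) : L →+* L) ((gramR L e dV hdV dW hdW).map (algebraMap (Fp L) L)))
      (h : HA L e dV hdV dW hdW) (v : (kindWFinset L e dV hdV dW hdW T₀ (S : Matrix (Fin n) (Fin n) L) h)) (s : ℂ), (S : Matrix (Fin n) (Fin n) L).det ≠ 0 →
      IsLocalSiegelSection (Fp L) L (IsCMField.complexConj L) (complexConj_imagUnit L) (imagUnit_ne_zero L) (imagUnit_mul_self L) v.1 n
        (gramR_isSymm L e dV hdV dW hdW) (hermD_eq_map_gramD L e dV hdV dW hdW) (χv v.1) s (FvT j S h v s))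
    (hfU : ∀ (j : Fin m) (S : skewMatrices ((IsCMField.complexConj L : L ≃ₐ[Fp L] L) : L →+* L) ((gramR L e dV hdV dW hdW).map (algebraMap (Fp L) L)))
      (h : HA L e dV hdV dW hdW) (v : (kindWFinset L e dV hdV dW hdW T₀ (S : Matrix (Fin n) (Fin n) L) h)), (S : Matrix (Fin n) (Fin n) L).det ≠ 0 →
      ∃ U : Subgroup (UnitaryGroup.localPi L (IsCMField.complexConj L) (n + n) (hermD L e dV hdV dW hdW) v.1),
        IsOpen (U : Set (UnitaryGroup.localPi L (IsCMField.complexConj L) (n + n) (hermD L e dV hdV dW hdW) v.1)) ∧ ∀ s g k, k ∈ U → FvT j S h v s (g * k) = FvT j S h v s g)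
    (hfc : ∀ (j : Fin m) (S : skewMatrices ((IsCMField.complexConj L : L ≃ₐ[Fp L] L) : L →+* L) ((gramR L e dV hdV dW hdW).map (algebraMap (Fp L) L)))
      (h : HA L e dV hdV dW hdW) (v : (kindWFinset L e dV hdV dW hdW T₀ (S : Matrix (Fin n) (Fin n) L) h)) (s : ℂ), (S : Matrix (Fin n) (Fin n) L).det ≠ 0 →
      Continuous (FvT j S h v s))
    (hdiff : ∀ (j : Fin m) (S : skewMatrices ((IsCMField.complexConj L : L ≃ₐ[Fp L] L) : L →+* L) ((gramR L e dV hdV dW hdW).map (algebraMap (Fp L) L)))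
      (h : HA L e dV hdV dW hdW) (v : (kindWFinset L e dV hdV dW hdW T₀ (S : Matrix (Fin n) (Fin n) L) h))
      (g : UnitaryGroup.localPi L (IsCMField.complexConj L) (n + n) (hermD L e dV hdV dW hdW) v.1), (S : Matrix (Fin n) (Fin n) L).det ≠ 0 →
      Differentiable ℂ fun s => FvT j S h v s g)
    (hbd : ∀ (j : Fin m) (S : skewMatrices ((IsCMField.complexConj L : L ≃ₐ[Fp L] L) : L →+* L) ((gramR L e dV hdV dW hdW).map (algebraMap (Fp L) L)))
      (h : HA L e dV hdV dW hdW) (v : (kindWFinset L e dV hdV dW hdW T₀ (S : Matrix (Fin n) (Fin n) L) h)), (S : Matrix (Fin n) (Fin n) L).det ≠ 0 →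
      ∀ Kc : Set (UnitaryGroup.localPi L (IsCMField.complexConj L) (n + n) (hermD L e dV hdV dW hdW) v.1), IsCompact Kc →
        ∀ s₀ : ℂ, ∃ r > 0, ∃ C : ℝ, ∀ s ∈ Metric.ball s₀ r, ∀ g ∈ Kc, ‖FvT j S h v s g‖ ≤ C)
    (hF0 : ∀ (j : Fin m) (S : skewMatrices ((IsCMField.complexConj L : L ≃ₐ[Fp L] L) : L →+* L) ((gramR L e dV hdV dW hdW).map (algebraMap (Fp L) L)))
      (h : HA L e dV hdV dW hdW) (v : (kindWFinset L e dV hdV dW hdW T₀ (S : Matrix (Fin n) (Fin n) L) h)) (s : ℂ)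
      (g : UnitaryGroup.localPi L (IsCMField.complexConj L) (n + n) (hermD L e dV hdV dW hdW) v.1), (S : Matrix (Fin n) (Fin n) L).det = 0 → FvT j S h v s g = 0) :
    ∀ (j : Fin m) (S : skewMatrices ((IsCMField.complexConj L : L ≃ₐ[Fp L] L) : L →+* L) ((gramR L e dV hdV dW hdW).map (algebraMap (Fp L) L)))
      (h : HA L e dV hdV dW hdW) (v : HeightOneSpectrum (𝓞 (Fp L))), DifferentiableOn ℂ (kindWFfin L e dV hdV dW hdW T₀ νv π FvT j S h v) {s : ℂ | 0 < s.re} := by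
  intro j S h v
  by_cases hv : v ∈ kindWFinset L e dV hdV dW hdW T₀ (S : Matrix (Fin n) (Fin n) L) h
  · by_cases hdet : (S : Matrix (Fin n) (Fin n) L).det = 0
    · have h0 : kindWFfin L e dV hdV dW hdW T₀ νv π FvT j S h v = fun _ => 0 :=
        funext fun s => kindWFfin_eq_zero_of_eq_zero L e dV hdV dW hdW T₀ νv π FvT j S h hv (fun s g => hF0 j S h ⟨v, hv⟩ s g hdet) s
      rw [h0]
      exact differentiableOn_const 0
    · obtain ⟨U, hU, hfU'⟩ := hfU j S h ⟨v, hv⟩ hdet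
      exact (differentiable_kindWFfin_of_isLocalSiegelSection L e dV hdV dW hdW hdV0 hdW0 T₀ νv hπ FvT j S h ⟨v, hv⟩ hdet (hχv v)
        (fun s => hf j S h ⟨v, hv⟩ s hdet) hU hfU' (fun s => hfc j S h ⟨v, hv⟩ s hdet) (fun g => hdiff j S h ⟨v, hv⟩ g hdet)
        (hbd j S h ⟨v, hv⟩ hdet)).differentiableOn
  · have h0 : kindWFfin L e dV hdV dW hdW T₀ νv π FvT j S h v = fun _ => 0 :=
      funext fun s => kindWFfin_of_not_mem L e dV hdV dW hdW T₀ νv π FvT j S h hv s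
    rw [h0]
    exact differentiableOn_const 0

end Head

end Summit.HodgeConjecture.HodgeConjecture.Cruxes.HLiu418.K2LiuKindWFiniteLetterHolomorphic

end
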